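import Literature.NumberTheory.LFunctions.VinogradovKorobovZeroDetector
import Literature.NumberTheory.LFunctions.ZetaEulerLowerBound
import Literature.Analysis.SpecialFunctions.SechSqFourier
import HarnessLib

/-!
# Ford's trigonometric integral inequality: Lemma 4.4 of Mossinghoff–Trudgian–Yang (Ford 2002, Lemma 5.1) for every degree

Topic `Literature/NumberTheory/LFunctions`. Part of the decomposition of the explicit
Vinogradov–Korobov zero-free region of Mossinghoff–Trudgian–Yang (*Res. Number Theory* 10 (2024)
= arXiv:2212.06867; architecture in `VinogradovKorobov.lean`). Everything here is PROVED; no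
definition and no named fact is introduced.

**Lemma 4.4 of the source** (= Ford, *Zero-free regions for the Riemann zeta function* (2002),
Lemma 5.1, "an immediate generalization to degree `K` polynomials"): for the coefficients `b_j`
of a non-negative trigonometric polynomial of degree `K`, real `t₁, t₂` and `η > 0`,

  `∫_{-∞}^{∞} (1/cosh²u) Σ_{j=1}^{K} b_j log|ζ(1 + η + ijt₁ + iut₂)| du ≥ −2 b₀ log ζ(1 + η)`.

This is hypothesis `h44` of the in-tree assembly of Lemma 4.7 of the source,
`Literature.NumberTheory.LFunctions.zero_inequality_mossinghoff_trudgian_yang_of_ford`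
(`VinogradovKorobovZeroDetector.lean`), in exactly that shape:
`Literature.NumberTheory.LFunctions.mty_lemma_4_4'`; the corollary
`Literature.NumberTheory.LFunctions.zero_inequality_mossinghoff_trudgian_yang_of_ford'` records
the assembly with `h44` discharged (three analytic hypotheses left: Ford's smoothed zero detector
`h42`, the far-zero bound `h46`, the kernel facts `hker`).

## Proof (Ford, proof of Lemma 5.1)

* the Euler product `log|ζ(s)| = Re Σ_p −log(1 − p^{−s}) = Σ_p Σ_{m ≥ 1} m⁻¹ p^{−mσ} cos(m t log p)`
  (`Re s = σ > 1`; Mathlib's `riemannZeta_eulerProduct_exp_log` and the Mercator series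
  `Complex.hasSum_taylorSeries_neg_log`; `‖p^{−s}‖ = p^{−σ}` from `ZetaEulerLowerBound.lean`) —
  `hasSum_eulerLogRe`, `hasSum_eulerLogRe_line`;
* Ford's (5.3), the cosine transform of `sech²`: `∫ cos(φ + yu)/cosh²u du = U(y) cos φ` with
  `0 ≤ U(y) = 2|Γ(1 + iy/2)|² = πy/sinh(πy/2) ≤ 2`
  (`Literature/Analysis/SpecialFunctions/SechSqFourier.lean`);
* two interchanges of sum and integral by dominated convergence
  (`MeasureTheory.hasSum_integral_of_dominated_convergence`; dominating functions
  `m⁻¹p^{−mσ}/cosh²u` and `(3/2)(Σ_j b_j) p^{−σ}/cosh²u`, the latter from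
  `|log(1 − z)| ≤ (3/2)|z|` for `|z| ≤ 1/2`) — `hasSum_integral_euler_line`, `mty_lemma_4_4_core`;
* the pointwise inequality `Σ_{j=1}^{K} b_j cos(jx) = P_K(x) − b₀ ≥ −b₀`, multiplied by
  `m⁻¹ p^{−mσ} U(m t₂ log p) ∈ [0, 2 m⁻¹p^{−mσ}]` and summed: `≥ −2b₀ Σ_{p,m} m⁻¹p^{−mσ}
  = −2b₀ log ζ(σ)` — `sum_integral_euler_ge`.

The statement is used (and proved) in the form `Σ_j b_j ∫ … ≥ −2b₀ log ζ(1+η)` (sum of the `K`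
absolutely convergent integrals), which is how `h44` is phrased; `K ≥ 2` and `b₁ > b₀` are not
needed.

## References

* M. J. Mossinghoff, T. S. Trudgian, A. Yang, *Explicit zero-free regions for the Riemann
  zeta-function*, Res. Number Theory 10 (2024) = arXiv:2212.06867, Lemma 4.4.
  (`MossinghoffTrudgianYangRNT2024`)
* K. Ford, *Zero-free regions for the Riemann zeta function*, Number Theory for the Millennium II
  (2002), 25–56 = arXiv:1910.08205, Lemma 5.1 and (5.2)–(5.3). (`Ford2002Millennium`)
-/

noncomputable section

open Complex Real MeasureTheory Finset Filter
open scoped Topology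

namespace Literature.NumberTheory.LFunctions

namespace FordTrig

open Literature.Analysis.SpecialFunctions

/-! ## Euler factors: `Re(−log(1 − p^{−s}))` -/

/-- `‖p^{−s}‖ < 1` for `Re s > 0` (`‖p^{−s}‖ = p^{−Re s}`, `norm_prime_cpow_neg` of
`ZetaEulerLowerBound.lean`). [folklore] -/
theorem norm_prime_cpow_neg_lt_one (p : Nat.Primes) {s : ℂ} (hs : 0 < s.re) :
    ‖(p : ℂ) ^ (-s)‖ < 1 := by
  rw [norm_prime_cpow_neg]
  exact prime_rpow_neg_lt_one p hs

/-- `‖p^{−s}‖ ≤ 1/2` for `Re s ≥ 1` (`p ≥ 2`). [folklore] -/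
theorem norm_prime_cpow_neg_le_half (p : Nat.Primes) {s : ℂ} (hs : 1 ≤ s.re) :
    ‖(p : ℂ) ^ (-s)‖ ≤ 1 / 2 := by
  rw [norm_prime_cpow_neg]
  have h2 : (2 : ℝ) ≤ p := by exact_mod_cast p.prop.two_le
  calc (p : ℝ) ^ (-s.re) ≤ (2 : ℝ) ^ (-s.re) :=
        Real.rpow_le_rpow_of_nonpos (by norm_num) h2 (by linarith)
    _ ≤ (2 : ℝ) ^ (-1 : ℝ) := Real.rpow_le_rpow_of_exponent_le (by norm_num) (by linarith)
    _ = 1 / 2 := by rw [Real.rpow_neg_one]; norm_num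

/-- `|Re(−log(1 − p^{−s}))| ≤ (3/2) p^{−Re s}` for `Re s ≥ 1` (from `|log(1+z)| ≤ (3/2)|z|`,
`|z| ≤ 1/2`). [folklore] -/
theorem abs_eulerLogRe_le (p : Nat.Primes) {s : ℂ} (hs : 1 ≤ s.re) :
    |(-Complex.log (1 - (p : ℂ) ^ (-s))).re| ≤ 3 / 2 * (p : ℝ) ^ (-s.re) := by
  have hz := norm_prime_cpow_neg_le_half p hs
  calc |(-Complex.log (1 - (p : ℂ) ^ (-s))).re| ≤ ‖-Complex.log (1 - (p : ℂ) ^ (-s))‖ :=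
        Complex.abs_re_le_norm _
    _ = ‖Complex.log (1 + -(p : ℂ) ^ (-s))‖ := by rw [norm_neg, sub_eq_add_neg]
    _ ≤ 3 / 2 * ‖-(p : ℂ) ^ (-s)‖ := Complex.norm_log_one_add_half_le_self (by rwa [norm_neg])
    _ = 3 / 2 * (p : ℝ) ^ (-s.re) := by rw [norm_neg, norm_prime_cpow_neg]

/-- Summability of the logarithms of the Euler factors of `ζ` (`Re s > 1`). [folklore] -/
theorem summable_neg_log_euler {s : ℂ} (hs : 1 < s.re) :
    Summable fun p : Nat.Primes ↦ -Complex.log (1 - (p : ℂ) ^ (-s)) := by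
  simpa only [MulChar.one_apply (isUnit_of_subsingleton _), one_mul] using
    DirichletCharacter.summable_neg_log_one_sub_mul_prime_cpow (1 : DirichletCharacter ℂ 1) hs

/-- **Euler product for `log|ζ|`**: `log|ζ(s)| = Σ_p Re(−log(1 − p^{−s}))` for `Re s > 1`.
[cite: Ford2002Millennium, (5.2)] -/
theorem hasSum_eulerLogRe {s : ℂ} (hs : 1 < s.re) :
    HasSum (fun p : Nat.Primes ↦ (-Complex.log (1 - (p : ℂ) ^ (-s))).re)
      (Real.log ‖riemannZeta s‖) := by
  have hsum := summable_neg_log_euler hs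
  rw [← riemannZeta_eulerProduct_exp_log hs, Complex.norm_exp, Real.log_exp]
  exact Complex.hasSum_re hsum.hasSum

/-- Summability of `p^{−σ}` over primes, `σ > 1`. [folklore] -/
theorem summable_prime_rpow_neg {σ : ℝ} (hσ : 1 < σ) :
    Summable fun p : Nat.Primes ↦ (p : ℝ) ^ (-σ) :=
  Nat.Primes.summable_rpow.mpr (by linarith)

/-- `|log|ζ(s)|| ≤ (3/2) Σ_p p^{−Re s}` for `Re s > 1`. [folklore] -/
theorem abs_log_norm_zeta_le {s : ℂ} (hs : 1 < s.re) :
    |Real.log ‖riemannZeta s‖| ≤ 3 / 2 * ∑' p : Nat.Primes, (p : ℝ) ^ (-s.re) := by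
  have h := hasSum_eulerLogRe hs
  have hS := summable_prime_rpow_neg hs
  have hb : ∀ p : Nat.Primes, ‖(-Complex.log (1 - (p : ℂ) ^ (-s))).re‖ ≤ 3 / 2 * (p : ℝ) ^ (-s.re) :=
    fun p ↦ by rw [Real.norm_eq_abs]; exact abs_eulerLogRe_le p hs.le
  have hn : Summable fun p : Nat.Primes ↦ ‖(-Complex.log (1 - (p : ℂ) ^ (-s))).re‖ :=
    (hS.mul_left (3 / 2)).of_nonneg_of_le (fun _ ↦ norm_nonneg _) hb
  rw [← h.tsum_eq, ← Real.norm_eq_abs, ← tsum_mul_left]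
  exact (norm_tsum_le_tsum_norm hn).trans (hn.tsum_le_tsum hb (hS.mul_left _))

/-- **Mercator expansion of one Euler factor on a vertical line**: for `σ > 0` and real `v`,
`Re(−log(1 − p^{−σ−iv})) = Σ_{m ≥ 1} m⁻¹ e^{−mσ log p} cos(m v log p)` (the term `m = 0` of the
Lean series is `0`). [cite: Ford2002Millennium, (5.2)] -/
theorem hasSum_eulerLogRe_line (p : Nat.Primes) {σ : ℝ} (hσ : 0 < σ) (v : ℝ) :
    HasSum (fun n : ℕ ↦ Real.exp (-(n * (σ * Real.log p))) / n * Real.cos (n * (Real.log p * v)))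
      (-Complex.log (1 - (p : ℂ) ^ (-((σ : ℂ) + (v : ℂ) * I)))).re := by
  set L : ℝ := Real.log p with hL
  have hp0 : (p : ℂ) ≠ 0 := by exact_mod_cast p.prop.ne_zero
  set w : ℂ := ((-(σ * L) : ℝ) : ℂ) + ((-(L * v) : ℝ) : ℂ) * I with hw
  have hz : (p : ℂ) ^ (-((σ : ℂ) + (v : ℂ) * I)) = Complex.exp w := by
    rw [Complex.cpow_def_of_ne_zero hp0, ← Complex.natCast_log, ← hL, hw]
    push_cast
    ring_nf
  have hnorm : ‖(p : ℂ) ^ (-((σ : ℂ) + (v : ℂ) * I))‖ < 1 :=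
    norm_prime_cpow_neg_lt_one p (by simpa using hσ)
  have h := Complex.hasSum_re (Complex.hasSum_taylorSeries_neg_log hnorm)
  have e : (fun n : ℕ ↦ (((p : ℂ) ^ (-((σ : ℂ) + (v : ℂ) * I))) ^ n / n).re) =
      fun n : ℕ ↦ Real.exp (-(n * (σ * L))) / n * Real.cos (n * (L * v)) := by
    funext n
    rw [Complex.div_natCast_re, hz, ← Complex.exp_nat_mul, Complex.exp_re]
    have hre : ((n : ℂ) * w).re = -(n * (σ * L)) := by simp [hw]
    have him : ((n : ℂ) * w).im = -(n * (L * v)) := by simp [hw]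
    rw [hre, him, Real.cos_neg]
    ring
  rw [e] at h
  exact h

/-- The real case `v = 0`: `Re(−log(1 − p^{−σ})) = Σ_{m ≥ 1} m⁻¹ e^{−mσ log p}`, a series of
non-negative terms. [folklore] -/
theorem hasSum_eulerLogRe_real (p : Nat.Primes) {σ : ℝ} (hσ : 0 < σ) :
    HasSum (fun n : ℕ ↦ Real.exp (-(n * (σ * Real.log p))) / n)
      (-Complex.log (1 - (p : ℂ) ^ (-(σ : ℂ)))).re := by
  have h := hasSum_eulerLogRe_line p hσ 0
  simp only [mul_zero, Real.cos_zero, mul_one, Complex.ofReal_zero, zero_mul, add_zero] at h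
  exact h

/-- Continuity of `u ↦ Re(−log(1 − p^{−s(u)}))` along the line `s(u) = σ + i(τ + κu)`, `σ > 0`.
[folklore] -/
theorem continuous_eulerLogRe_line (p : Nat.Primes) {σ : ℝ} (hσ : 0 < σ) (τ κ : ℝ) :
    Continuous fun u : ℝ ↦
      (-Complex.log (1 - (p : ℂ) ^ (-((σ : ℂ) + ((τ + u * κ : ℝ) : ℂ) * I)))).re := by
  have hp0 : (p : ℂ) ≠ 0 := by exact_mod_cast p.prop.ne_zero
  have h1 : Continuous fun u : ℝ ↦ (p : ℂ) ^ (-((σ : ℂ) + ((τ + u * κ : ℝ) : ℂ) * I)) :=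
    Continuous.const_cpow (by fun_prop) (Or.inl hp0)
  have h2 : Continuous fun u : ℝ ↦
      Complex.log (1 - (p : ℂ) ^ (-((σ : ℂ) + ((τ + u * κ : ℝ) : ℂ) * I))) := by
    refine Continuous.clog (continuous_const.sub h1) fun u ↦ ?_
    rw [sub_eq_add_neg]
    refine Complex.mem_slitPlane_of_norm_lt_one ?_
    rw [norm_neg]
    exact norm_prime_cpow_neg_lt_one p (by simpa using hσ)
  exact Complex.continuous_re.comp h2.neg

/-! ## Integrals against `1/cosh²` -/

/-- A continuous function with `|f| ≤ M` is integrable against `1/cosh²u`. [folklore] -/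
theorem integrable_div_cosh_sq_of_bound {f : ℝ → ℝ} (hf : Continuous f) {M : ℝ}
    (hM : ∀ u, |f u| ≤ M) : Integrable fun u : ℝ ↦ f u / Real.cosh u ^ 2 := by
  refine (integrable_inv_cosh_sq.const_mul M).mono' ?_ (ae_of_all _ fun u ↦ ?_)
  · exact (hf.div (by fun_prop) fun u ↦ by positivity).aestronglyMeasurable
  · have hc : 0 < Real.cosh u ^ 2 := by positivity
    rw [Real.norm_eq_abs, abs_div, abs_of_pos hc, mul_one_div]
    exact div_le_div_of_nonneg_right (hM u) hc.le

/-- `log|ζ|` is continuous along a vertical line `Re s = σ > 1`. [folklore] -/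
theorem continuous_log_norm_zeta_line {σ : ℝ} (hσ : 1 < σ) (τ κ : ℝ) :
    Continuous fun u : ℝ ↦ Real.log ‖riemannZeta ((σ : ℂ) + ((τ + u * κ : ℝ) : ℂ) * I)‖ := by
  have hline : Continuous fun u : ℝ ↦ (σ : ℂ) + ((τ + u * κ : ℝ) : ℂ) * I := by fun_prop
  have hre : ∀ u : ℝ, ((σ : ℂ) + ((τ + u * κ : ℝ) : ℂ) * I).re = σ := by intro u; simp
  have hζ : Continuous fun u : ℝ ↦ riemannZeta ((σ : ℂ) + ((τ + u * κ : ℝ) : ℂ) * I) := by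
    refine continuous_iff_continuousAt.2 fun u ↦ ?_
    have hne : (σ : ℂ) + ((τ + u * κ : ℝ) : ℂ) * I ≠ 1 := by
      intro h
      have := congrArg Complex.re h
      rw [hre] at this
      simp only [Complex.one_re] at this
      linarith
    exact ContinuousAt.comp (f := fun u : ℝ ↦ (σ : ℂ) + ((τ + u * κ : ℝ) : ℂ) * I)
      (differentiableAt_riemannZeta hne).continuousAt hline.continuousAt
  refine hζ.norm.log fun u ↦ ?_
  exact (norm_pos_iff.mpr (riemannZeta_ne_zero_of_one_lt_re (by rw [hre]; exact hσ))).ne'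

/-- `log|ζ(s(u))|/cosh²u` is integrable along a vertical line `Re s = σ > 1`. [folklore] -/
theorem integrable_log_norm_zeta_line {σ : ℝ} (hσ : 1 < σ) (τ κ : ℝ) :
    Integrable fun u : ℝ ↦
      Real.log ‖riemannZeta ((σ : ℂ) + ((τ + u * κ : ℝ) : ℂ) * I)‖ / Real.cosh u ^ 2 := by
  refine integrable_div_cosh_sq_of_bound (continuous_log_norm_zeta_line hσ τ κ)
    (M := 3 / 2 * ∑' p : Nat.Primes, (p : ℝ) ^ (-σ)) fun u ↦ ?_
  have hs : 1 < ((σ : ℂ) + ((τ + u * κ : ℝ) : ℂ) * I).re := by simpa using hσ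
  have h := abs_log_norm_zeta_le hs
  simpa using h

/-- `Re(−log(1 − p^{−s(u)}))/cosh²u` is integrable along a vertical line `Re s = σ ≥ 1`, `σ > 0`.
[folklore] -/
theorem integrable_eulerLogRe_line (p : Nat.Primes) {σ : ℝ} (hσ : 1 ≤ σ) (τ κ : ℝ) :
    Integrable fun u : ℝ ↦
      (-Complex.log (1 - (p : ℂ) ^ (-((σ : ℂ) + ((τ + u * κ : ℝ) : ℂ) * I)))).re
        / Real.cosh u ^ 2 := by
  refine integrable_div_cosh_sq_of_bound (continuous_eulerLogRe_line p (by linarith) τ κ)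
    (M := 3 / 2 * (p : ℝ) ^ (-σ)) fun u ↦ ?_
  have hs : 1 ≤ ((σ : ℂ) + ((τ + u * κ : ℝ) : ℂ) * I).re := by simpa using hσ
  have h := abs_eulerLogRe_le p hs
  simpa using h

/-! ## The inner interchange: one Euler factor along one line -/

/-- **One Euler factor, one line, summed over prime powers**: for `σ > 1`,
`∫ Re(−log(1 − p^{−σ−i(τ+κu)}))/cosh²u du = Σ_{m ≥ 1} m⁻¹e^{−mσ log p} U(mκ log p) cos(mτ log p)`
with `U(y) = 2|Γ(1 + iy/2)|² = ∫ cos(yu)/cosh²u du` (dominated convergence, Ford's (5.3)).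
[cite: Ford2002Millennium, proof of Lemma 5.1] -/
theorem hasSum_integral_euler_line (p : Nat.Primes) {σ : ℝ} (hσ : 1 < σ) (τ κ : ℝ) :
    HasSum (fun n : ℕ ↦ Real.exp (-(n * (σ * Real.log p))) / n *
        (2 * ‖Complex.Gamma (1 + ((n * (Real.log p * κ) / 2 : ℝ) : ℂ) * I)‖ ^ 2
          * Real.cos (n * (Real.log p * τ))))
      (∫ u : ℝ, (-Complex.log (1 - (p : ℂ) ^ (-((σ : ℂ) + ((τ + u * κ : ℝ) : ℂ) * I)))).re
        / Real.cosh u ^ 2) := by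
  set L : ℝ := Real.log p with hL
  set c : ℕ → ℝ := fun n ↦ Real.exp (-(n * (σ * L))) / n with hc
  have hc0 : ∀ n, 0 ≤ c n := fun n ↦ div_nonneg (Real.exp_pos _).le n.cast_nonneg
  have hcsum : Summable c := (hasSum_eulerLogRe_real p (by linarith : 0 < σ)).summable
  have hF := hasSum_integral_of_dominated_convergence (μ := volume)
    (F := fun (n : ℕ) (u : ℝ) ↦ c n * (Real.cos (n * (L * τ) + (n * (L * κ)) * u) / Real.cosh u ^ 2))
    (f := fun u : ℝ ↦ (-Complex.log (1 - (p : ℂ) ^ (-((σ : ℂ) + ((τ + u * κ : ℝ) : ℂ) * I)))).re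
        / Real.cosh u ^ 2)
    (fun n u ↦ c n * (1 / Real.cosh u ^ 2)) ?_ ?_ ?_ ?_ ?_
  · refine hF.congr_fun fun n ↦ ?_
    rw [integral_const_mul, integral_cos_add_mul_div_cosh_sq]
  · intro n
    refine (continuous_const.mul ?_).aestronglyMeasurable
    exact (Continuous.div (by fun_prop) (by fun_prop) fun u ↦ by positivity)
  · intro n
    refine ae_of_all _ fun u ↦ ?_
    have hch : 0 < Real.cosh u ^ 2 := by positivity
    rw [Real.norm_eq_abs, abs_mul, abs_of_nonneg (hc0 n), abs_div, abs_of_pos hch]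
    exact mul_le_mul_of_nonneg_left
      (div_le_div_of_nonneg_right (Real.abs_cos_le_one _) hch.le) (hc0 n)
  · exact ae_of_all _ fun u ↦ hcsum.mul_right _
  · have e : (fun u : ℝ ↦ ∑' n : ℕ, c n * (1 / Real.cosh u ^ 2)) =
        fun u ↦ (∑' n : ℕ, c n) * (1 / Real.cosh u ^ 2) := by
      funext u; exact tsum_mul_right
    rw [e]
    exact integrable_inv_cosh_sq.const_mul _
  · refine ae_of_all _ fun u ↦ ?_
    have h := (hasSum_eulerLogRe_line p (by linarith : 0 < σ) (τ + u * κ)).div_const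
      (Real.cosh u ^ 2)
    refine h.congr_fun fun n ↦ ?_
    simp only [hc, hL]
    rw [mul_div_assoc]
    congr 2
    ring

/-! ## The trigonometric inequality and the per-prime lower bound -/

/-- For a non-negative trigonometric polynomial, `Σ_{j=1}^{K} b_j cos(jx) = P_K(x) − b₀ ≥ −b₀`.
[cite: Ford2002Millennium, (5.1)] -/
theorem sum_mul_cos_ge {K : ℕ} {b : ℕ → ℝ} (hb : IsNonnegTrigPoly K b) (x : ℝ) :
    -b 0 ≤ ∑ j ∈ Finset.range K, b (j + 1) * Real.cos (((j : ℝ) + 1) * x) := by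
  have h := hb.2.2 x
  rw [trigPoly, Finset.sum_range_succ'] at h
  push_cast at h
  simp only [zero_mul, Real.cos_zero, mul_one] at h
  linarith

/-- `U(y) = 2|Γ(1 + iy/2)|² ≤ 2`. [cite: Ford2002Millennium, proof of Lemma 5.1] -/
theorem two_mul_norm_Gamma_sq_le_two (y : ℝ) :
    2 * ‖Complex.Gamma (1 + ((y / 2 : ℝ) : ℂ) * I)‖ ^ 2 ≤ 2 := by
  rw [← integral_cos_mul_div_cosh_sq]
  exact integral_cos_mul_div_cosh_sq_le_two y

/-- **The per-prime inequality** (Ford's proof of Lemma 5.1, last display): for `σ > 1`,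
`Σ_{j=1}^{K} b_j ∫ Re(−log(1 − p^{−σ−i(jt₁+κu)}))/cosh²u du ≥ −2b₀ Re(−log(1 − p^{−σ}))`.
[cite: Ford2002Millennium, proof of Lemma 5.1] -/
theorem sum_integral_euler_ge (p : Nat.Primes) {σ : ℝ} (hσ : 1 < σ) {K : ℕ} {b : ℕ → ℝ}
    (hb : IsNonnegTrigPoly K b) (t₁ κ : ℝ) :
    -2 * b 0 * (-Complex.log (1 - (p : ℂ) ^ (-(σ : ℂ)))).re ≤
      ∑ j ∈ Finset.range K, b (j + 1) *
        ∫ u : ℝ, (-Complex.log (1 - (p : ℂ) ^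
            (-((σ : ℂ) + ((((j : ℝ) + 1) * t₁ + u * κ : ℝ) : ℂ) * I)))).re / Real.cosh u ^ 2 := by
  set L : ℝ := Real.log p with hL
  -- the two sides as sums over prime powers
  have hR := hasSum_sum (s := Finset.range K) fun j _ ↦
    (hasSum_integral_euler_line p hσ (((j : ℝ) + 1) * t₁) κ).mul_left (b (j + 1))
  have hLft := (hasSum_eulerLogRe_real p (by linarith : 0 < σ)).mul_left (-2 * b 0)
  refine hasSum_le (fun n ↦ ?_) hLft hR
  -- termwise: `-2 b₀ c ≤ Σ_j b_{j+1} c U cos((j+1) x)` with `x = n t₁ log p`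
  set c : ℝ := Real.exp (-(n * (σ * L))) / n
  set U : ℝ := 2 * ‖Complex.Gamma (1 + ((n * (L * κ) / 2 : ℝ) : ℂ) * I)‖ ^ 2
  have hc0 : 0 ≤ c := div_nonneg (Real.exp_pos _).le n.cast_nonneg
  have hU0 : 0 ≤ U := by positivity
  have hU2 : U ≤ 2 := two_mul_norm_Gamma_sq_le_two _
  have hb0 : 0 ≤ b 0 := hb.1 0
  have htrig := sum_mul_cos_ge hb (n * (L * t₁))
  have e : ∑ j ∈ Finset.range K, b (j + 1) * (c * (U * Real.cos (n * (L * (((j : ℝ) + 1) * t₁)))))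
      = c * U * ∑ j ∈ Finset.range K, b (j + 1) * Real.cos (((j : ℝ) + 1) * (n * (L * t₁))) := by
    rw [Finset.mul_sum]
    refine Finset.sum_congr rfl fun j _ ↦ ?_
    rw [show (n : ℝ) * (L * (((j : ℝ) + 1) * t₁)) = ((j : ℝ) + 1) * (n * (L * t₁)) by ring]
    ring
  rw [e]
  have h1 : c * U * (-b 0) ≤ c * U * ∑ j ∈ Finset.range K, b (j + 1) *
      Real.cos (((j : ℝ) + 1) * (n * (L * t₁))) :=
    mul_le_mul_of_nonneg_left htrig (mul_nonneg hc0 hU0)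
  have h2 : -2 * b 0 * c ≤ c * U * (-b 0) := by nlinarith [mul_nonneg hc0 hb0]
  exact h2.trans h1

/-! ## The outer interchange and the lemma -/

/-- **Lemma 4.4 of Mossinghoff–Trudgian–Yang, core form**: for `σ > 1`, a non-negative
trigonometric polynomial `b` of degree `K` and real `t₁, κ`,
`−2b₀ log|ζ(σ)| ≤ ∫ Σ_{j=1}^{K} b_j log|ζ(σ + i(jt₁ + κu))|/cosh²u du`.
[cite: MossinghoffTrudgianYangRNT2024, Lemma 4.4] [cite: Ford2002Millennium, Lemma 5.1] -/
theorem mty_lemma_4_4_core {σ : ℝ} (hσ : 1 < σ) {K : ℕ} {b : ℕ → ℝ} (hb : IsNonnegTrigPoly K b)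
    (t₁ κ : ℝ) :
    -2 * b 0 * Real.log ‖riemannZeta σ‖ ≤
      ∫ u : ℝ, ∑ j ∈ Finset.range K, b (j + 1) *
        (Real.log ‖riemannZeta ((σ : ℂ) + ((((j : ℝ) + 1) * t₁ + u * κ : ℝ) : ℂ) * I)‖
          / Real.cosh u ^ 2) := by
  set B₁ : ℝ := ∑ j ∈ Finset.range K, b (j + 1) with hB₁
  have hB₁0 : 0 ≤ B₁ := Finset.sum_nonneg fun j _ ↦ hb.1 (j + 1)
  have hS := summable_prime_rpow_neg hσ
  -- the line through `σ + i(j+1)t₁`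
  have hre : ∀ (j : ℕ) (u : ℝ),
      ((σ : ℂ) + ((((j : ℝ) + 1) * t₁ + u * κ : ℝ) : ℂ) * I).re = σ := by intro j u; simp
  -- dominated convergence over the primes
  have hF := hasSum_integral_of_dominated_convergence (μ := volume) (ι := Nat.Primes)
    (F := fun (p : Nat.Primes) (u : ℝ) ↦ ∑ j ∈ Finset.range K, b (j + 1) *
      ((-Complex.log (1 - (p : ℂ) ^
          (-((σ : ℂ) + ((((j : ℝ) + 1) * t₁ + u * κ : ℝ) : ℂ) * I)))).re / Real.cosh u ^ 2))
    (f := fun u : ℝ ↦ ∑ j ∈ Finset.range K, b (j + 1) *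
        (Real.log ‖riemannZeta ((σ : ℂ) + ((((j : ℝ) + 1) * t₁ + u * κ : ℝ) : ℂ) * I)‖
          / Real.cosh u ^ 2))
    (fun p u ↦ B₁ * (3 / 2 * (p : ℝ) ^ (-σ)) * (1 / Real.cosh u ^ 2)) ?_ ?_ ?_ ?_ ?_
  · -- compare the two `HasSum`s over the primes termwise
    have hσ' : 1 < ((σ : ℝ) : ℂ).re := by simpa using hσ
    have hLft := (hasSum_eulerLogRe hσ').mul_left (-2 * b 0)
    refine hasSum_le (fun p ↦ ?_) hLft hF
    rw [integral_finsetSum _ fun j _ ↦ (integrable_eulerLogRe_line p hσ.le _ κ).const_mul _]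
    simp_rw [integral_const_mul]
    exact sum_integral_euler_ge p hσ hb t₁ κ
  · -- measurability
    intro p
    refine (continuous_finsetSum _ fun j _ ↦ continuous_const.mul ?_).aestronglyMeasurable
    exact (continuous_eulerLogRe_line p (by linarith) _ κ).div (by fun_prop) fun u ↦ by positivity
  · -- domination
    intro p
    refine ae_of_all _ fun u ↦ ?_
    have hch : 0 < Real.cosh u ^ 2 := by positivity
    calc ‖∑ j ∈ Finset.range K, b (j + 1) * ((-Complex.log (1 - (p : ℂ) ^
            (-((σ : ℂ) + ((((j : ℝ) + 1) * t₁ + u * κ : ℝ) : ℂ) * I)))).re / Real.cosh u ^ 2)‖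
        ≤ ∑ j ∈ Finset.range K, ‖b (j + 1) * ((-Complex.log (1 - (p : ℂ) ^
            (-((σ : ℂ) + ((((j : ℝ) + 1) * t₁ + u * κ : ℝ) : ℂ) * I)))).re / Real.cosh u ^ 2)‖ :=
          norm_sum_le _ _
      _ ≤ ∑ j ∈ Finset.range K, b (j + 1) * ((3 / 2 * (p : ℝ) ^ (-σ)) * (1 / Real.cosh u ^ 2)) := by
          refine Finset.sum_le_sum fun j _ ↦ ?_
          have hg := abs_eulerLogRe_le p
            (s := (σ : ℂ) + ((((j : ℝ) + 1) * t₁ + u * κ : ℝ) : ℂ) * I) (by rw [hre]; exact hσ.le)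
          rw [hre] at hg
          rw [norm_mul, Real.norm_of_nonneg (hb.1 _), Real.norm_eq_abs, abs_div, abs_of_pos hch,
            ← mul_one_div _ (Real.cosh u ^ 2)]
          exact mul_le_mul_of_nonneg_left (mul_le_mul_of_nonneg_right hg (by positivity)) (hb.1 _)
      _ = B₁ * (3 / 2 * (p : ℝ) ^ (-σ)) * (1 / Real.cosh u ^ 2) := by
          rw [← Finset.sum_mul, hB₁]; ring
  · -- summability of the dominating sequence
    exact ae_of_all _ fun u ↦ ((hS.mul_left (3 / 2)).mul_left B₁).mul_right _
  · -- integrability of its sum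
    have e : (fun u : ℝ ↦ ∑' p : Nat.Primes, B₁ * (3 / 2 * (p : ℝ) ^ (-σ)) * (1 / Real.cosh u ^ 2))
        = fun u ↦ (∑' p : Nat.Primes, B₁ * (3 / 2 * (p : ℝ) ^ (-σ))) * (1 / Real.cosh u ^ 2) := by
      funext u; exact tsum_mul_right
    rw [e]
    exact integrable_inv_cosh_sq.const_mul _
  · -- pointwise Euler product on each of the `K` lines
    refine ae_of_all _ fun u ↦ hasSum_sum fun j _ ↦ ?_
    exact ((hasSum_eulerLogRe (s := (σ : ℂ) + ((((j : ℝ) + 1) * t₁ + u * κ : ℝ) : ℂ) * I)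
      (by rw [hre]; exact hσ)).div_const (Real.cosh u ^ 2)).mul_left (b (j + 1))

/-- `Re ζ(σ) = |ζ(σ)|` for real `σ > 1`. [folklore] -/
theorem re_zeta_eq_norm {σ : ℝ} (hσ : 1 < σ) : (riemannZeta σ).re = ‖riemannZeta σ‖ := by
  have him := riemannZeta_im_eq_zero_of_one_lt hσ
  have hre := riemannZeta_re_pos_of_one_lt hσ
  rw [← Complex.re_add_im (riemannZeta σ), him]
  simp [abs_of_pos hre]

end FordTrig

open FordTrig in
/-- **Lemma 4.4 of Mossinghoff–Trudgian–Yang** (Ford 2002, Lemma 5.1, for every degree): for a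
non-negative trigonometric polynomial `P_K(x) = Σ_{k=0}^{K} b_k cos(kx)`, real `t₁, t₂` and
`η > 0`,
`Σ_{j=1}^{K} b_j ∫_{-∞}^{∞} log|ζ(1 + η + ijt₁ + iut₂)|/cosh²u du ≥ −2b₀ log ζ(1 + η)`.
(Stated with the sum of the `K` absolutely convergent integrals; the hypothesis `2 ≤ K` is carried
only to match the shape of `h44` in `zero_inequality_mossinghoff_trudgian_yang_of_ford` and is not
used.) [cite: MossinghoffTrudgianYangRNT2024, Lemma 4.4] [cite: Ford2002Millennium, Lemma 5.1] -/
theorem mty_lemma_4_4 (K : ℕ) (b : ℕ → ℝ) (_hK : 2 ≤ K) (hb : IsNonnegTrigPoly K b)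
    (η t₁ t₂ : ℝ) (hη : 0 < η) :
    -2 * b 0 * Real.log (riemannZeta (1 + η)).re ≤
      ∑ j ∈ Finset.range K, b (j + 1) * fordLogZetaIntegral (1 + η) (((j : ℝ) + 1) * t₁) t₂ := by
  have hσ : 1 < 1 + η := by linarith
  have h := mty_lemma_4_4_core hσ hb t₁ t₂
  rw [integral_finsetSum _ fun j _ ↦ (integrable_log_norm_zeta_line hσ _ t₂).const_mul _] at h
  simp_rw [integral_const_mul] at h
  have e1 : (riemannZeta (1 + (η : ℂ))).re = ‖riemannZeta ((1 + η : ℝ) : ℂ)‖ := by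
    rw [show (1 : ℂ) + η = ((1 + η : ℝ) : ℂ) by push_cast; ring]
    exact re_zeta_eq_norm hσ
  rw [e1]
  unfold fordLogZetaIntegral
  exact h

/-- Lemma 4.4 of Mossinghoff–Trudgian–Yang in the exact shape of hypothesis `h44` of
`zero_inequality_mossinghoff_trudgian_yang_of_ford`. [cite: MossinghoffTrudgianYangRNT2024, Lemma 4.4] -/
theorem mty_lemma_4_4' : ∀ (K : ℕ) (b : ℕ → ℝ), 2 ≤ K → IsNonnegTrigPoly K b → ∀ η t₁ t₂ : ℝ, 0 < η →
    -2 * b 0 * Real.log (riemannZeta (1 + η)).re ≤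
      ∑ j ∈ Finset.range K, b (j + 1) * fordLogZetaIntegral (1 + η) (((j : ℝ) + 1) * t₁) t₂ :=
  fun K b hK hb η t₁ t₂ hη ↦ mty_lemma_4_4 K b hK hb η t₁ t₂ hη

/-- **Lemma 4.7 of Mossinghoff–Trudgian–Yang with Lemma 4.4 discharged**: the assembly
`zero_inequality_mossinghoff_trudgian_yang_of_ford` of `VinogradovKorobovZeroDetector.lean` with its
hypothesis `h44` supplied by `mty_lemma_4_4'`; what remains are Ford's smoothed zero detector
(`h42` = Ford Lemma 4.6 with MTY Lemma 4.3), the far-zero bound (`h46` = MTY Lemma 4.6) and the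
kernel facts (`hker`). [cite: MossinghoffTrudgianYangRNT2024, Lemma 4.7] -/
theorem zero_inequality_mossinghoff_trudgian_yang_of_ford'
    (h42 : ∀ A B : ℝ, 1 < A → 0 < B → RichertBound A B → ∀ η : ℝ, 0 < η → η ≤ 1 / 2 →
      ∀ (f : ℝ → ℝ) (D : ℝ), IsFordSmoothing f η D →
        (∀ t : ℝ, 1000 ≤ t → ∀ S : ℝ, FordFarZeroSumLE t η S → FordDetectorIneq A B η f D t S) ∧
          (fordK f 1).re ≤ (fordLaplace f 0).re + 1.8 * D)
    (h46 : ∀ A B : ℝ, 1 < A → 0 < B → RichertBound A B → ∀ t η : ℝ, 10000 ≤ t → 0 < η → η ≤ 1 / 4 →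
      FordFarZeroSumLE t η (mtyFarZeroBound A B t η))
    (hker : ∀ θ : ℝ, 0 < θ → θ < π / 2 → FordKernelFacts θ) :
    zero_inequality_mossinghoff_trudgian_yang :=
  zero_inequality_mossinghoff_trudgian_yang_of_ford h42 mty_lemma_4_4' h46 hker

end Literature.NumberTheory.LFunctions
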